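import Literature.AnabelianGeometry.EtaleTheta.Discharge.Sec2EnvelopeLemmas
import Literature.AnabelianGeometry.EtaleTheta.MonoThetaEnv
import HarnessLib

/-!
# [EtTh] Remark 2.14.1 — the ENGINE: if the shift `α_δ` of Prop. 2.14 (ii) extended to `Π^tp_X[μ_N]` as a cocycle
# shift, the `Gal(Y/X)`-translates of the theta cocycle would be in arithmetic progression mod `N`
# (generic over `ThetaEnvData`; proof-only companion)

Mochizuki, *The Étale Theta Function and its Frobenioid-theoretic Manifestations* [EtTh], Publ. RIMS **45**
(2009), §2, Remark 2.14.1, PRIMS PDF p. 51 (printed p. 277), with Prop. 2.14 (ii) p. 49 and its proof p. 50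
(locators `p.N` = PDF pages; bib key `MochizukiEtTh2009`) [cite: MochizukiEtTh2009, Rmk 2.14.1 p.51].
Cell `abc-iut`, layer L2 [EtTh], seat abc-iut-w6-d076 (gen 5), row «RMK2141-NOGO@modelχq» (abc-iut-L2-lead R1137),
part 1 of 2.  PROOF-ONLY companion of `ThetaRigidity.lean` (abc-iut-L2-t2; Remark 2.14.1 is recorded there as
documentation, l. 229–239) over `MonoThetaEnv.lean` (`ThetaEnvData`, `sTheta`, `conjX`) and `CyclotomicEnvelope.lean`
(`CycEnvelope.IsEnvCocycle`, `shift`, `coboundary`): no definition, no instance, no notation, no new named fact.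

PRINT (p. 51): "Note that, in the notation of Proposition 2.14, (ii), although the automorphism `α̈_δ` extends to
an automorphism `α_δ` of `Π^tp_Y[μ_N]`, the automorphism `α_δ` fails to extend to `Π^tp_X[μ_N]` [i.e., since `Ü²`
fails to descend from `Y` to `X`!]; thus, it is essential to work with homomorphisms `s^Θ_Ÿ, t^Θ_Ÿ : Π^tp_Ÿ →
Π^tp_Y[μ_N]`, as opposed to composites of such homomorphisms with the natural inclusion `Π^tp_Y[μ_N] ↪ Π^tp_X[μ_N]`."
Here (proof of (ii), p. 50) `t^Θ` is a `K^×, (l·ℤ)`-conjugate of `s^Θ`, `δ = t^Θ − s^Θ` on `Π^tp_Ÿ`, and "`δ`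
extends to a cocycle of `Π^tp_Y`", whose shift is `α_δ`.

READING (recorded, not adjudicated).  (1) «Extends to `Π^tp_X[μ_N]`» is typed in the currency in which the typed
Prop. 2.14 (ii) (`RigidData.Prop214_ii`) types «`α̈_δ` extends to `α_δ`»: as the extension of the COCYCLE — a
`μ_N`-valued 1-cocycle `ε` of `Π^tp_X` (for `χ ∘ aug`) restricting to `δ` on `Π^tp_Y`; its shift `α_ε` is then an
automorphism of `Π^tp_X[μ_N] = μ_N ⋊ Π^tp_X` inducing the identity on `Π^tp_X` and on `μ_N` and restricting to `α_δ`
on `Π^tp_Y[μ_N]` (every automorphism inducing the identity on both is such a shift).  The reading «extends to an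
ARBITRARY automorphism of `Π^tp_X[μ_N]`» additionally involves the centraliser of `Π^tp_Y[μ_N]` in `Π^tp_X[μ_N]` and is
not typed here.  (2) For `t^Θ` the `Gal(Y/X)`-conjugate `x·s^Θ` of `s^Θ` by `x ∈ Π^tp_X`, `δ|_{Π^tp_Ÿ} = η/(x·η)` with
`(x·η)(g) = χ(x)·η(x⁻¹ g x)` (`difference_eq_of_shift_sTheta_eq_conjX`).

PROVED here (generic, for EVERY `T : ThetaEnvData N`, hypothesis-free algebra):
* `CycEnvelope.IsEnvCocycle.chi_apply_conj` — a cocycle `ε` of `Π` is `Π`-invariant up to the coboundary of its own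
  value: `χ(x)·ε(x⁻¹ g x) = ε(g) · ∂(ε x)(g)⁻¹`;
* `ThetaEnvData.exists_coboundary_of_difference_extension` — if a cocycle `ε` of `Π^tp_X` restricts on `Π^tp_Ÿ` to
  the difference `η/(x·η)`, then that difference is `x`-INVARIANT up to a `μ_N`-coboundary on `Π^tp_Ÿ`:
  `(x·η)/(x²·η) = (η/(x·η)) · ∂m⁻¹`;
* `ThetaEnvData.exists_coboundary_sq_translate_of_difference_extension` — equivalently the SECOND DIFFERENCE of the
  translates vanishes mod coboundaries: `η · (x²·η) = (x·η)² · ∂m` on `Π^tp_Ÿ` («the `l·ℤ`-translates of the theta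
  cocycle are in arithmetic progression mod `N`»);
* `ThetaEnvData.exists_coboundary_sq_translate_of_extension` — the same with the hypotheses in the currency of
  Prop. 2.14 (ii): `α_δ ∘ s^Θ_η = x·s^Θ_η` on `Π^tp_Ÿ` and `ε|_{Π^tp_Y} = δ`.
Part 2 (`Sec2Remark2141NoGoModelTate.lean`) contradicts the conclusion at the cell's Tate datum of record, where the
second difference of the translates of `η̈^Θ` is the Kummer class of `q̈^{−2l²}` («`Gal(Y/X)` maps `Ü²` to a
`K^×`-multiple of `Ü²`», p. 50), nonzero mod `N` for `N ∤ 2l`.  HONEST FRAMING: [EtTh] is refereed; these are kernel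
checks of elementary cocycle algebra; nothing of [EtTh] is endorsed or disputed; no side is taken on [IUTchIII]
Cor. 3.12; typed ≠ proved elsewhere.
-/

namespace Literature.AnabelianGeometry.EtaleTheta

universe u

namespace CycEnvelope

variable {P G μ : Type*} [Group P] [Group G] [CommGroup μ] {aug : P →* G} {χ : G →* MulAut μ}

/-- **A cocycle is invariant under its own group up to a coboundary, pointwise**: for a 1-cocycle `ε` of `Π`
(for `χ ∘ aug`) and `x, g ∈ Π`, `χ(x)·ε(x⁻¹ g x) = ε(g) · ∂(ε x)(g)⁻¹` — the cocycle identity applied to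
`x · (x⁻¹ g x) = g · x` (the conjugation action of `Π` on `H¹(Π, μ_N)` is trivial).
[cite: MochizukiEtTh2009, Prop 2.14(ii) p.49] -/
theorem IsEnvCocycle.chi_apply_conj {ε : P → μ} (hε : IsEnvCocycle aug χ ε) (x g : P) :
    χ (aug x) (ε (x⁻¹ * g * x)) = ε g * (coboundary aug χ (ε x) g)⁻¹ := by
  have h1 : ε (x * (x⁻¹ * g * x)) = ε x * χ (aug x) (ε (x⁻¹ * g * x)) := hε x _
  have h2 : x * (x⁻¹ * g * x) = g * x := by group
  rw [h2, hε g x] at h1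
  rw [coboundary, mul_inv_rev, inv_inv, eq_inv_mul_of_mul_eq h1.symm, mul_comm ((ε x)⁻¹), mul_assoc]

end CycEnvelope

namespace ThetaEnvData

variable {N : ℕ+} (T : ThetaEnvData.{u} N)

/-- Conjugates of elements of `Π^tp_Ÿ` by elements of `Π^tp_X` stay in `Π^tp_Ÿ` (`Π^tp_Ÿ ⊴ Π^tp_X`, p. 41).
[cite: MochizukiEtTh2009, Def 2.13 p.47] -/
theorem inv_mul_mul_mem_PiYdd (x : T.PiX) (g : T.PiYdd) : x⁻¹ * (g : T.PiX) * x ∈ T.PiYdd := by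
  simpa [mul_assoc] using T.PiYdd_normal.conj_mem _ g.2 x⁻¹

/-- **In the notation of Prop. 2.14 (ii)**: if the shift `α_δ` by a cocycle `δ` of `Π^tp_Y` carries the theta section
`s^Θ_η` to its `Gal(Y/X)`-conjugate `x·s^Θ_η : g ↦ conj_x(s^Θ_η(x⁻¹ g x))`, then on `Π^tp_Ÿ` the cocycle `δ` IS the
difference `η/(x·η)`, `(x·η)(g) = χ(x)·η(x⁻¹ g x)` ("the difference `t^Θ − s^Θ` … a cocycle `δ : Π^tp_Ÿ → μ_N`",
p. 49). [cite: MochizukiEtTh2009, Prop 2.14(ii) p.49] -/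
theorem difference_eq_of_shift_sTheta_eq_conjX (x : T.PiX) {η : T.PiYdd → T.mu} (hη : η ∈ T.thetaCocycles)
    {δ : T.PiY → T.mu} (hδ : CycEnvelope.IsEnvCocycle T.augY T.chi δ)
    (hshift : ∀ g : T.PiYdd, CycEnvelope.shift hδ (T.sTheta hη g) =
      T.conjX x (T.sTheta hη ⟨x⁻¹ * g * x, T.inv_mul_mul_mem_PiYdd x g⟩))
    (g : T.PiYdd) :
    δ (T.inclYdd g) = η g * (T.chi (T.aug x) (η ⟨x⁻¹ * g * x, T.inv_mul_mul_mem_PiYdd x g⟩))⁻¹ := by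
  have h := congrArg SemidirectProduct.left (hshift g)
  change (η g)⁻¹ * δ (T.inclYdd g) =
    T.chi (T.aug x) (η ⟨x⁻¹ * g * x, T.inv_mul_mul_mem_PiYdd x g⟩)⁻¹ at h
  rw [map_inv] at h
  exact eq_mul_of_inv_mul_eq h

/-- **The engine of Remark 2.14.1, invariance form.** If a cocycle `ε` of `Π^tp_X` (for `χ ∘ aug`) restricts on
`Π^tp_Ÿ` to the difference `η/(x·η)` of a function `η` and its `x`-translate (`x ∈ Π^tp_X`), then that difference is
`x`-INVARIANT on `Π^tp_Ÿ` up to the coboundary of `m := ε(x)`: `(x·η)/(x²·η) = (η/(x·η)) · ∂m⁻¹` — the restriction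
of a class of `H¹(Π^tp_X, μ_N)` to the normal subgroup `Π^tp_Ÿ` is `Π^tp_X`-invariant.
[cite: MochizukiEtTh2009, Rmk 2.14.1 p.51] -/
theorem exists_coboundary_of_difference_extension (x : T.PiX) (η : T.PiYdd → T.mu) {ε : T.PiX → T.mu}
    (hε : CycEnvelope.IsEnvCocycle T.aug T.chi ε)
    (hεη : ∀ g : T.PiYdd, ε g = η g * (T.chi (T.aug x) (η ⟨x⁻¹ * g * x, T.inv_mul_mul_mem_PiYdd x g⟩))⁻¹) :
    ∃ m : T.mu, ∀ g : T.PiYdd,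
      T.chi (T.aug x) (η ⟨x⁻¹ * g * x, T.inv_mul_mul_mem_PiYdd x g⟩) *
          (T.chi (T.aug (x * x)) (η ⟨(x * x)⁻¹ * g * (x * x), T.inv_mul_mul_mem_PiYdd (x * x) g⟩))⁻¹ =
        η g * (T.chi (T.aug x) (η ⟨x⁻¹ * g * x, T.inv_mul_mul_mem_PiYdd x g⟩))⁻¹ *
          (CycEnvelope.coboundary (T.aug.comp T.PiYdd.subtype) T.chi m g)⁻¹ := by
  refine ⟨ε x, fun g => ?_⟩
  have key := hε.chi_apply_conj x (g : T.PiX)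
  have e1 : ε (x⁻¹ * (g : T.PiX) * x) = ε ((⟨x⁻¹ * g * x, T.inv_mul_mul_mem_PiYdd x g⟩ : T.PiYdd) : T.PiX) := rfl
  rw [e1, hεη, hεη g, map_mul, map_inv] at key
  have e2 : (⟨x⁻¹ * (((⟨x⁻¹ * (g : T.PiX) * x, T.inv_mul_mul_mem_PiYdd x g⟩ : T.PiYdd)) : T.PiX) * x,
        T.inv_mul_mul_mem_PiYdd x ⟨x⁻¹ * g * x, T.inv_mul_mul_mem_PiYdd x g⟩⟩ : T.PiYdd) =
      ⟨(x * x)⁻¹ * g * (x * x), T.inv_mul_mul_mem_PiYdd (x * x) g⟩ := by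
    apply Subtype.ext
    change x⁻¹ * (x⁻¹ * (g : T.PiX) * x) * x = (x * x)⁻¹ * g * (x * x)
    group
  have e3 : T.chi (T.aug x) (T.chi (T.aug x)
        (η ⟨x⁻¹ * (((⟨x⁻¹ * (g : T.PiX) * x, T.inv_mul_mul_mem_PiYdd x g⟩ : T.PiYdd)) : T.PiX) * x,
          T.inv_mul_mul_mem_PiYdd x ⟨x⁻¹ * g * x, T.inv_mul_mul_mem_PiYdd x g⟩⟩)) =
      T.chi (T.aug (x * x)) (η ⟨(x * x)⁻¹ * g * (x * x), T.inv_mul_mul_mem_PiYdd (x * x) g⟩) := by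
    rw [e2, map_mul, map_mul, MulAut.mul_apply]
  rw [e3] at key
  exact key

/-- **The engine of Remark 2.14.1, second-difference form**: under the same hypothesis the SECOND DIFFERENCE of the
`x`-translates of `η` is a coboundary on `Π^tp_Ÿ`: `η · (x²·η) = (x·η)² · ∂m` — «the `Gal(Y/X)`-translates of the theta
cocycle would be in arithmetic progression mod `N`», which Part 2 refutes at the Tate datum of record («`Gal(Y/X)`
maps `Ü²` to a `K^×`-multiple of `Ü²`», p. 50: the second difference is the Kummer class of a power of `q̈`).
[cite: MochizukiEtTh2009, Rmk 2.14.1 p.51] -/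
theorem exists_coboundary_sq_translate_of_difference_extension (x : T.PiX) (η : T.PiYdd → T.mu)
    {ε : T.PiX → T.mu} (hε : CycEnvelope.IsEnvCocycle T.aug T.chi ε)
    (hεη : ∀ g : T.PiYdd, ε g = η g * (T.chi (T.aug x) (η ⟨x⁻¹ * g * x, T.inv_mul_mul_mem_PiYdd x g⟩))⁻¹) :
    ∃ m : T.mu, ∀ g : T.PiYdd,
      η g * T.chi (T.aug (x * x)) (η ⟨(x * x)⁻¹ * g * (x * x), T.inv_mul_mul_mem_PiYdd (x * x) g⟩) =
        T.chi (T.aug x) (η ⟨x⁻¹ * g * x, T.inv_mul_mul_mem_PiYdd x g⟩) ^ 2 *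
          CycEnvelope.coboundary (T.aug.comp T.PiYdd.subtype) T.chi m g := by
  obtain ⟨m, hm⟩ := T.exists_coboundary_of_difference_extension x η hε hεη
  refine ⟨m, fun g => ?_⟩
  have h := hm g
  set A := η g
  set B := T.chi (T.aug x) (η ⟨x⁻¹ * g * x, T.inv_mul_mul_mem_PiYdd x g⟩)
  set C := T.chi (T.aug (x * x)) (η ⟨(x * x)⁻¹ * g * (x * x), T.inv_mul_mul_mem_PiYdd (x * x) g⟩)
  set k := CycEnvelope.coboundary (T.aug.comp T.PiYdd.subtype) T.chi m g
  -- `h : B * C⁻¹ = A * B⁻¹ * k⁻¹`; goal `A * C = B ^ 2 * k`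
  have hC : C = (A * B⁻¹ * k⁻¹)⁻¹ * B := by
    rw [← h]; group
  rw [hC, pow_two]
  apply (Additive.ofMul : T.mu ≃ Additive T.mu).injective
  simp only [ofMul_mul, ofMul_inv]
  abel

/-- **Remark 2.14.1, engine in the currency of Prop. 2.14 (ii).** Let `η` be a theta cocycle, `x ∈ Π^tp_X`,
`δ` a cocycle of `Π^tp_Y` whose shift `α_δ` carries `s^Θ_η` to the `Gal(Y/X)`-conjugate `x·s^Θ_η` (Prop. 2.14 (ii)),
and SUPPOSE `α_δ` extends to `Π^tp_X[μ_N]` as the shift by a cocycle `ε` of `Π^tp_X` restricting to `δ`.  Then the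
second difference of the `x`-translates of `η` is a `μ_N`-coboundary on `Π^tp_Ÿ`: `η · (x²·η) = (x·η)² · ∂m`.
[cite: MochizukiEtTh2009, Rmk 2.14.1 p.51] -/
theorem exists_coboundary_sq_translate_of_extension (x : T.PiX) {η : T.PiYdd → T.mu}
    (hη : η ∈ T.thetaCocycles) {δ : T.PiY → T.mu} (hδ : CycEnvelope.IsEnvCocycle T.augY T.chi δ)
    (hshift : ∀ g : T.PiYdd, CycEnvelope.shift hδ (T.sTheta hη g) =
      T.conjX x (T.sTheta hη ⟨x⁻¹ * g * x, T.inv_mul_mul_mem_PiYdd x g⟩))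
    {ε : T.PiX → T.mu} (hε : CycEnvelope.IsEnvCocycle T.aug T.chi ε) (hext : ∀ y : T.PiY, ε y = δ y) :
    ∃ m : T.mu, ∀ g : T.PiYdd,
      η g * T.chi (T.aug (x * x)) (η ⟨(x * x)⁻¹ * g * (x * x), T.inv_mul_mul_mem_PiYdd (x * x) g⟩) =
        T.chi (T.aug x) (η ⟨x⁻¹ * g * x, T.inv_mul_mul_mem_PiYdd x g⟩) ^ 2 *
          CycEnvelope.coboundary (T.aug.comp T.PiYdd.subtype) T.chi m g :=
  T.exists_coboundary_sq_translate_of_difference_extension x η hε fun g => by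
    rw [← T.difference_eq_of_shift_sTheta_eq_conjX x hη hδ hshift g]
    exact hext (T.inclYdd g)

end ThetaEnvData

end Literature.AnabelianGeometry.EtaleTheta
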